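import Mathlib
import Summits.NavierStokesRegularity.NavierStokesRegularity.Theses.BarrierStepRungThree

/-!
# Disturbance absorption for the window barrier certificate (route BarrierStepRungThree)

Item `stmt-NavierStokesRegularity-23649` (`DisturbanceAbsorption`, support, split gen 1 of
`BarrierCertificate`).  A finite-dimensional, table-free lemma: linearity of the Fréchet
derivative, the operator-norm bound `‖fderiv ℝ v x‖ ≤ Λ` (sup norm on `Fin 4 → Fin n → ℝ`) and the
absorption budget `Λ · η · 4^(kLo+j) · √Φ_j ≤ γ` turn an undisturbed decrease
`(fderiv ℝ v x) w ≤ -2γ` into the robust decrease `(fderiv ℝ v x) (w + d) ≤ -γ` for every defect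
`d` in the box `|d i j| ≤ η · 4^(kLo+j) · √Φ_j`.

This closes a support item of a line bearing on rung TL-M3 of the Tao ladder only; no statement
about Navier–Stokes regularity (Clay A–D) is proved here.
-/

-- the summit and the sub-problem share the name `NavierStokesRegularity` (single-conjunct summit, D-0017)
set_option linter.dupNamespace false

namespace Summit.NavierStokesRegularity.NavierStokesRegularity.Theorems

open Summit.NavierStokesRegularity.NavierStokesRegularity.Theses.BarrierStepRungThree

/-- Elementary absorption inequality behind `DisturbanceAbsorption`: if a continuous linear
functional `L` on `Fin 4 → Fin n → ℝ` (sup norm) satisfies `L w ≤ -2γ`, `‖L‖ ≤ Λ` with `0 ≤ Λ`,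
and the perturbation `d` is entrywise bounded by numbers `b j` with `Λ * b j ≤ γ` for every `j`,
then `L (w + d) ≤ -γ`. -/
theorem clm_add_le_of_opNorm_budget {n : ℕ} (L : (Fin 4 → Fin n → ℝ) →L[ℝ] ℝ)
    (γ Λ : ℝ) (b : Fin n → ℝ) (w d : Fin 4 → Fin n → ℝ) (hγ : 0 ≤ γ) (hΛ : 0 ≤ Λ)
    (hw : L w ≤ -(2 * γ)) (hL : ‖L‖ ≤ Λ) (hb : ∀ j : Fin n, Λ * b j ≤ γ)
    (hd : ∀ (i : Fin 4) (j : Fin n), |d i j| ≤ b j) : L (w + d) ≤ -γ := by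
  have hLd : L d ≤ Λ * ‖d‖ := by
    calc L d ≤ |L d| := le_abs_self _
      _ = ‖L d‖ := (Real.norm_eq_abs _).symm
      _ ≤ ‖L‖ * ‖d‖ := L.le_opNorm d
      _ ≤ Λ * ‖d‖ := mul_le_mul_of_nonneg_right hL (norm_nonneg _)
  have habs : Λ * ‖d‖ ≤ γ := by
    rcases eq_or_lt_of_le hΛ with hΛ0 | hΛpos
    · rw [← hΛ0, zero_mul]; exact hγ
    · have hdn : ‖d‖ ≤ γ / Λ := by
        refine (pi_norm_le_iff_of_nonneg (div_nonneg hγ hΛ)).2 fun i => ?_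
        refine (pi_norm_le_iff_of_nonneg (div_nonneg hγ hΛ)).2 fun j => ?_
        rw [Real.norm_eq_abs]
        calc |d i j| ≤ b j := hd i j
          _ ≤ γ / Λ := by rw [le_div_iff₀ hΛpos, mul_comm]; exact hb j
      calc Λ * ‖d‖ ≤ Λ * (γ / Λ) := mul_le_mul_of_nonneg_left hdn hΛ
        _ = γ := mul_div_cancel₀ γ hΛpos.ne'
  rw [map_add]
  linarith

/-- **DisturbanceAbsorption** (item `stmt-NavierStokesRegularity-23649` of route
`BarrierStepRungThree`, support, split gen 1 of `BarrierCertificate`): for every window size `n`,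
base shell `kLo`, margin `η`, rate `γ ≥ 0`, gradient bound `Λ ≥ 0`, clock `v`, caps `Φ ≥ 0`,
point `x`, drift `w` and defect `d` with `(fderiv ℝ v x) w ≤ -2γ`, `‖fderiv ℝ v x‖ ≤ Λ`,
budget `Λ · (η · 2^(2(kLo+j)) · √Φ_j) ≤ γ` and `|d i j| ≤ η · 2^(2(kLo+j)) · √Φ_j`, one has
`(fderiv ℝ v x) (w + d) ≤ -γ`.  Proof: `map_add`, `le_opNorm`, `pi_norm_le_iff_of_nonneg`. -/
theorem disturbanceAbsorption_proof : DisturbanceAbsorption := by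
  unfold DisturbanceAbsorption
  intro n kLo η γ Λ v Φ x w d hγ hΛ hw hL _hΦ hbudget hd
  exact clm_add_le_of_opNorm_budget (fderiv ℝ v x) γ Λ
    (fun j => η * (1 + 1 : ℝ) ^ ((2 : ℝ) * ((kLo + (j : ℕ) : ℤ) : ℝ)) * Real.sqrt (Φ j))
    w d hγ hΛ hw hL hbudget hd

end Summit.NavierStokesRegularity.NavierStokesRegularity.Theorems
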